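import Literature.MathematicalPhysics.PowerSystems.DroopMicrogridVoltageProfile

/-!
# Droop-controlled microgrid (Schiffer–Ortega–Astolfi–Raisch–Sezi 2014 / Shin–Zavala 2020):
# the FLAT synchronous state is an equilibrium (no active-power set-points) and is locally
# exponentially stable modulo the rotation — Prop. 5.9's condition (31) discharged structurally

Topic `Literature/MathematicalPhysics/PowerSystems` (LADDER-GRIDFUSION rung G3.b; seat gridfusion-lit-2,
g13).  Closes the loop between `DroopMicrogridEquilibriumConvergence.lean` (Cor. 5.12: with
`P^u = 0` every trajectory approaches the equilibrium SET `E`), `DroopMicrogridVoltageProfile.lean`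
(`E` is the graph of the voltage profile `V°` over the angle solutions of `P(θ, V°(θ)) = P^u`) and
`DroopMicrogridHamiltonianStability.lean` (Prop. 5.9: an equilibrium whose `(θ, V)`-Hessian block
(36) is positive definite in a reference gauge is locally exponentially stable modulo rotation):
at a FLAT state — all angles equal — the cross block `W(x*)` of (36) VANISHES (`sin θ*_ij = 0`), the
angle block is the Laplacian `L(x*)` with weights `B_ij V*_i V*_j > 0` (kernel = constants for a
connected coupling graph) and `D + T(x*) ≻ 0` (dominantly inductive network, `Q^u > 0`), so (31)
holds with nothing to check.  0 named facts.

* §1 `hessW_eq_zero_of_flat`; `hessDT_quadForm_pos` (`D + T(x) ≻ 0` as a quadratic form, for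
  symmetric `B` with `B_ij ≥ 0`, row sums `≤ 0`, `Q^u > 0`, `V > 0` — the companion's
  `posDef_hessD_add_hessT` assumed zero row sums); `thetaVBlock_quadForm_eq_of_flat`;
  **`thetaVBlock_pos_of_flat`** — (36) is positive definite on `{y_θ,i₀ = 0}` at every flat state
  with `V > 0` of a connected network;
* §2 **`flatState_expStable_modRotation`** — every flat equilibrium with `V* > 0` is locally
  exponentially stable modulo the rotation (conclusion of `expStable_modRotation_of_hessian`), for
  ALL positive gains and time constants; **`flatState_mem_equilibria`** — with `P^u = 0` the flat
  states `(c𝟙, 0, V°(c𝟙))` ARE equilibria; **`flatState_expStable`** — the two combined: with no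
  active-power set-points the flat synchronous state of a connected dominantly inductive droop
  microgrid is a locally exponentially stable (mod rotation) equilibrium, whatever the gains.

THREE COLUMNS.  Mathematics about the MODEL (9)/(21)–(22) (lossless, Kron-reduced, balanced,
first-order filters); «stable» = the rotation orbit of the model's flat equilibrium attracts a
`ρ`-ball exponentially.  Nothing here says a microgrid is stable.

## References

* J. Schiffer, R. Ortega, A. Astolfi, J. Raisch, T. Sezi, *Conditions for stability of droop-controlled
  inverter-based microgrids*, Automatica 50 (2014) 2457–2469, doi:10.1016/j.automatica.2014.08.009 —
  §5.3 Lemma 5.8 (held text p0012 L7–L15: «L is a symmetric Laplacian matrix of a connected graph …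
  Hence, L > 0»), Proposition 5.9 with (31), (35)–(36) (p0012 L23–L57), Remark 5.11 (p0012 L71:
  «independent of the frequency droop gains k_Pi, the active power setpoints P^d_i and … τ_Pi»),
  Corollary 5.12 (p0013 L11–L25). [SchifferEtAl2014]
* S. Shin, V. M. Zavala, *Stabilization of Port-Hamiltonian Systems with Applications to Microgrids*,
  arXiv:2002.09802 (2020) — eq. (15) (blocks `L, W, A, D, T`), Prop. 1, Prop. 2 (small angle
  differences). [ShinZavala2020]

AI-produced formalisation (LADDER-GRIDFUSION seat gridfusion-lit-2 g13, 2026-08-28).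
-/

noncomputable section

open Set Filter Topology Finset Metric Real
open scoped Matrix BigOperators

namespace Literature.MathematicalPhysics.PowerSystems

namespace DroopPH

variable {n : ℕ} (M : DroopPH n)

/-! ## §1 The (θ, V)-block of the Hessian at a flat state -/

/-- At a flat state (all angles equal) the cross block `W(x)` of (15)/(36) vanishes.
[cite: ShinZavala2020, eq. (15) (`W_ij = B_ij V_i sin θ_ij`)] -/
theorem hessW_eq_zero_of_flat (x : State n) (hflat : ∀ i j, x.1 i = x.1 j) : M.hessW x = 0 := by
  have h0 : ∀ i k, sin (x.1 i - x.1 k) = 0 := fun i k => by rw [hflat i k, sub_self, sin_zero]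
  ext i j
  simp [hessW, h0, Matrix.diagonal]

/-- **`D + T(x) ≻ 0` (quadratic-form version) for a dominantly inductive network**: `B` symmetric,
`B_ij ≥ 0` (`i ≠ j`), row sums `Σ_j B_ij ≤ 0`, `Q^u_i > 0`, `V_i ≠ 0`.  (`wᵀTw = −Σ B_ij cos θ_ij w_iw_j
≥ 0` by the companion's `cosForm_nonpos`; `wᵀDw = Σ Q^u_i w_i²/V_i² > 0` for `w ≠ 0`.)
[cite: ShinZavala2020, §IV-B («T is PSD … D is PD»); SchifferEtAl2014, Lemma 5.8] -/
theorem hessDT_quadForm_pos (hB : ∀ i j, M.B i j = M.B j i) (hBoff : ∀ i j, i ≠ j → 0 ≤ M.B i j)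
    (hBrow : ∀ i, ∑ j, M.B i j ≤ 0) (hQu : ∀ i, 0 < M.Qu i) (x : State n) (hV : ∀ i, x.2.2 i ≠ 0)
    {w : Fin n → ℝ} (hw : w ≠ 0) : 0 < w ⬝ᵥ ((M.hessD x + M.hessT x) *ᵥ w) := by
  rw [Matrix.add_mulVec, dotProduct_add]
  have hT : 0 ≤ w ⬝ᵥ (M.hessT x *ᵥ w) := by
    have e : w ⬝ᵥ (M.hessT x *ᵥ w) = -∑ i, ∑ j, M.B i j * cos (x.1 i - x.1 j) * w i * w j := by
      simp only [dotProduct, Matrix.mulVec, hessT, Matrix.of_apply, Finset.mul_sum, ← Finset.sum_neg_distrib]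
      refine Finset.sum_congr rfl fun i _ => Finset.sum_congr rfl fun j _ => ?_
      ring
    rw [e, neg_nonneg]
    exact M.cosForm_nonpos hB hBoff hBrow x.1 w
  have hD : 0 < w ⬝ᵥ (M.hessD x *ᵥ w) := by
    obtain ⟨i, hi⟩ := Function.ne_iff.1 hw
    have hcoef : ∀ j, 0 < M.Qu j / x.2.2 j ^ 2 := fun j =>
      div_pos (hQu j) (lt_of_le_of_ne (sq_nonneg _) (Ne.symm (pow_ne_zero 2 (hV j))))
    have hterm : ∀ j, 0 ≤ w j * (M.Qu j / x.2.2 j ^ 2 * w j) := fun j => by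
      nlinarith [hcoef j, sq_nonneg (w j)]
    simp only [hessD, Matrix.mulVec_diagonal, dotProduct]
    refine lt_of_lt_of_le ?_ (Finset.single_le_sum (fun j _ => hterm j) (Finset.mem_univ i))
    have hwi : 0 < w i ^ 2 := lt_of_le_of_ne (sq_nonneg _) (Ne.symm (pow_ne_zero 2 hi))
    nlinarith [hcoef i]
  linarith

/-- The quadratic form of the `(θ, V)`-block (36) at a flat state splits:
`yᵀ [L W; Wᵀ D+T] y = uᵀLu + wᵀ(D+T)w` (`y = (u, w)`, `W = 0`). [cite: SchifferEtAl2014, (36)] -/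
theorem thetaVBlock_quadForm_eq_of_flat (x : State n) (hflat : ∀ i j, x.1 i = x.1 j)
    (y : Fin n ⊕ Fin n → ℝ) :
    y ⬝ᵥ (M.hessThetaV x *ᵥ y)
      = (fun i => y (Sum.inl i)) ⬝ᵥ (M.hessL x *ᵥ fun i => y (Sum.inl i))
        + (fun i => y (Sum.inr i)) ⬝ᵥ ((M.hessD x + M.hessT x) *ᵥ fun i => y (Sum.inr i)) := by
  have hy : y = Sum.elim (fun i => y (Sum.inl i)) (fun i => y (Sum.inr i)) := by
    ext (i | i) <;> rfl
  conv_lhs => rw [hy]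
  rw [hessThetaV, M.hessW_eq_zero_of_flat x hflat, Matrix.transpose_zero, Matrix.fromBlocks_mulVec,
    Sum.elim_comp_inl, Sum.elim_comp_inr, sumElim_dotProduct_sumElim, Matrix.zero_mulVec,
    Matrix.zero_mulVec, add_zero, zero_add]

/-- **The `(θ, V)`-block (36) is positive definite in a reference gauge at every flat state with
`V > 0` of a connected, dominantly inductive network** (`B` symmetric, `B_ij ≥ 0`, row sums `≤ 0`,
coupling graph of `B` connected, `Q^u > 0`): `yᵀ(36)y > 0` for `y ≠ 0` with `y_θ,i₀ = 0` — i.e.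
Schiffer et al.'s condition (31) holds at flat states with nothing to check.
[cite: SchifferEtAl2014, Lemma 5.8 and Proposition 5.9 (31), (36); ShinZavala2020, Prop. 2] -/
theorem thetaVBlock_pos_of_flat (hB : ∀ i j, M.B i j = M.B j i)
    (hBoff : ∀ i j, i ≠ j → 0 ≤ M.B i j) (hBrow : ∀ i, ∑ j, M.B i j ≤ 0)
    (hconn : ClassicalModel.CouplingConnected M.B) (hQu : ∀ i, 0 < M.Qu i) (x : State n)
    (hV : ∀ i, 0 < x.2.2 i) (hflat : ∀ i j, x.1 i = x.1 j) (i₀ : Fin n)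
    (y : Fin n ⊕ Fin n → ℝ) (hy0 : y (Sum.inl i₀) = 0) (hy : y ≠ 0) :
    0 < y ⬝ᵥ (M.hessThetaV x *ᵥ y) := by
  rw [M.thetaVBlock_quadForm_eq_of_flat x hflat y]
  set u : Fin n → ℝ := fun i => y (Sum.inl i) with hu
  set w : Fin n → ℝ := fun i => y (Sum.inr i) with hw
  have hθ : ∀ i j, |x.1 i - x.1 j| ≤ π / 2 := fun i j => by
    rw [hflat i j, sub_self, abs_zero]; positivity
  have hcoh : ∀ i j, i ≠ j → 0 < M.B i j → |x.1 i - x.1 j| < π / 2 := fun i j _ _ => by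
    rw [hflat i j, sub_self, abs_zero]; positivity
  have hL : 0 ≤ u ⬝ᵥ (M.hessL x *ᵥ u) :=
    M.hessL_quadForm_nonneg hB hBoff x (fun i => (hV i).le) hθ u
  by_cases hw0 : w = 0
  · -- then `u ≠ 0`, and `uᵀLu = 0` would force `u` constant `= u_{i₀} = 0`
    have hu0 : u ≠ 0 := by
      intro hu0
      apply hy
      ext (i | i)
      · exact congrFun hu0 i
      · exact congrFun hw0 i
    have hLpos : 0 < u ⬝ᵥ (M.hessL x *ᵥ u) := by
      refine lt_of_le_of_ne hL fun hzero => hu0 ?_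
      obtain ⟨c, hc⟩ :=
        (M.hessL_quadForm_eq_zero_iff hB hBoff hconn x hV hθ hcoh u).1 hzero.symm
      have hc0 : c = 0 := by
        have h := congrFun hc i₀
        rw [hu] at h
        simp only at h
        rw [hy0] at h
        exact h.symm
      rw [hc, hc0]; rfl
    rw [hw0, Matrix.mulVec_zero, dotProduct_zero, add_zero]
    exact hLpos
  · have hDT := M.hessDT_quadForm_pos hB hBoff hBrow hQu x (fun i => (hV i).ne') hw0
    linarith

/-! ## §2 The flat synchronous state is a locally exponentially stable equilibrium -/

/-- **Every flat equilibrium with `V* > 0` is locally exponentially stable modulo the rotation**,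
for ALL positive gains `k_P, k_Q` and time constants `τ_P, τ_Q` (`B` symmetric, `B_ij ≥ 0`, row sums
`≤ 0`, connected coupling graph, `Q^u > 0`): Prop. 5.9 with its condition (31) discharged by
`thetaVBlock_pos_of_flat`; the conclusion is that of `expStable_modRotation_of_hessian`
(`‖X t − (x* + (c𝟙, 0, 0))‖ ≤ k‖X 0 − x*‖e^{−λt}` from a `ρ`-ball).
[cite: SchifferEtAl2014, Proposition 5.9 and Remark 5.11; ShinZavala2020, Prop. 1, Prop. 2] -/
theorem flatState_expStable_modRotation (hB : ∀ i j, M.B i j = M.B j i)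
    (hBoff : ∀ i j, i ≠ j → 0 ≤ M.B i j) (hBrow : ∀ i, ∑ j, M.B i j ≤ 0)
    (hconn : ClassicalModel.CouplingConnected M.B)
    (hkP : ∀ i, 0 < M.kP i) (hτP : ∀ i, 0 < M.τP i) (hkQ : ∀ i, 0 < M.kQ i) (hτQ : ∀ i, 0 < M.τQ i)
    (hQu : ∀ i, 0 < M.Qu i) {xs : State n} (heq : M.field xs = 0) (hV : ∀ i, 0 < xs.2.2 i)
    (hflat : ∀ i j, xs.1 i = xs.1 j) (i₀ : Fin n) :
    ∃ ρ > 0, ∃ k > 0, ∃ lam > 0, ∀ (X : ℝ → State n) (T : ℝ), M.IsSolutionOn X (Icc 0 T) →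
      ‖X 0 - xs‖ < ρ → ∃ c : ℝ, ∀ t ∈ Icc 0 T,
        ‖X t - (xs + ((fun _ => c, 0, 0) : State n))‖ ≤ k * ‖X 0 - xs‖ * Real.exp (-lam * t) :=
  M.expStable_modRotation_of_thetaVBlock_posDef hB hkP hτP hkQ hτQ heq hV i₀ fun y hy0 hy =>
    M.thetaVBlock_pos_of_flat hB hBoff hBrow hconn hQu xs hV hflat i₀ y hy0 hy

/-- The active power injections vanish at a flat angle vector. [cite: ShinZavala2020, §III-A (`P_i = Σ V_iV_jB_ij sin θ_ij`)] -/
theorem P_eq_zero_of_flat (θ V : Fin n → ℝ) (hflat : ∀ i j, θ i = θ j) (i : Fin n) :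
    M.P θ V i = 0 := by
  simp only [DroopPH.P]
  exact Finset.sum_eq_zero fun j _ => by rw [hflat i j, sub_self, sin_zero, mul_zero]

/-- **With no active-power set-points (`P^u = 0`, the setting of Cor. 5.12) the flat states
`(c𝟙, 0, V°(c𝟙))` are equilibria of (9).** [cite: SchifferEtAl2014, Corollary 5.12 and Remark 4.3; ShinZavala2020, §II-D] -/
theorem flatState_mem_equilibria (hB : ∀ i j, M.B i j = M.B j i)
    (hBoff : ∀ i j, i ≠ j → 0 ≤ M.B i j) (hBrow : ∀ i, ∑ j, M.B i j ≤ 0)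
    (hkP : ∀ i, 0 < M.kP i) (hτP : ∀ i, 0 < M.τP i) (hkQ : ∀ i, 0 < M.kQ i) (hτQ : ∀ i, 0 < M.τQ i)
    (hQu : ∀ i, 0 < M.Qu i) (hPu : ∀ i, M.Pu i = 0) (c : ℝ) :
    (((fun _ => c), 0, M.voltageProfile hB hBoff hBrow hkQ hQu fun _ => c) : State n)
      ∈ M.equilibria := by
  refine (M.mem_equilibria_iff hB hBoff hBrow hkP hτP hkQ hτQ hQu _).2 ⟨rfl, rfl, fun i => ?_⟩
  rw [hPu i]
  exact M.P_eq_zero_of_flat _ _ (fun _ _ => rfl) i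

/-- **THE FLAT SYNCHRONOUS STATE OF A DROOP MICROGRID WITHOUT ACTIVE-POWER SET-POINTS IS A LOCALLY
EXPONENTIALLY STABLE EQUILIBRIUM (modulo rotation), for all positive gains and time constants.**
`B` symmetric, `B_ij ≥ 0`, row sums `≤ 0`, connected coupling graph, `Q^u > 0`, `P^u = 0`: for every
`c`, `x* = (c𝟙, 0, V°(c𝟙))` is an equilibrium with `V* > 0` and there are `ρ, k, λ > 0` with
`‖X t − (x* + (c'𝟙, 0, 0))‖ ≤ k‖X 0 − x*‖e^{−λt}` (some `c'`) for every solution on `[0, T]` from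
the `ρ`-ball — the local counterpart of Cor. 5.12's global statement (every trajectory approaches
the equilibrium set). [cite: SchifferEtAl2014, Proposition 5.9, Remark 5.11, Corollary 5.12; ShinZavala2020, Prop. 1–2] -/
theorem flatState_expStable (hB : ∀ i j, M.B i j = M.B j i)
    (hBoff : ∀ i j, i ≠ j → 0 ≤ M.B i j) (hBrow : ∀ i, ∑ j, M.B i j ≤ 0)
    (hconn : ClassicalModel.CouplingConnected M.B)
    (hkP : ∀ i, 0 < M.kP i) (hτP : ∀ i, 0 < M.τP i) (hkQ : ∀ i, 0 < M.kQ i) (hτQ : ∀ i, 0 < M.τQ i)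
    (hQu : ∀ i, 0 < M.Qu i) (hPu : ∀ i, M.Pu i = 0) (c : ℝ) (i₀ : Fin n) :
    (((fun _ => c), 0, M.voltageProfile hB hBoff hBrow hkQ hQu fun _ => c) : State n) ∈ M.equilibria ∧
    ∃ ρ > 0, ∃ k > 0, ∃ lam > 0, ∀ (X : ℝ → State n) (T : ℝ), M.IsSolutionOn X (Icc 0 T) →
      ‖X 0 - (((fun _ => c), 0, M.voltageProfile hB hBoff hBrow hkQ hQu fun _ => c) : State n)‖ < ρ →
      ∃ c' : ℝ, ∀ t ∈ Icc 0 T,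
        ‖X t - ((((fun _ => c), 0, M.voltageProfile hB hBoff hBrow hkQ hQu fun _ => c) : State n)
            + ((fun _ => c', 0, 0) : State n))‖
          ≤ k * ‖X 0 - (((fun _ => c), 0, M.voltageProfile hB hBoff hBrow hkQ hQu fun _ => c) : State n)‖
              * Real.exp (-lam * t) := by
  have hmem := M.flatState_mem_equilibria hB hBoff hBrow hkP hτP hkQ hτQ hQu hPu c
  exact ⟨hmem, M.flatState_expStable_modRotation hB hBoff hBrow hconn hkP hτP hkQ hτQ hQu hmem.1
    hmem.2 (fun _ _ => rfl) i₀⟩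

end DroopPH

end Literature.MathematicalPhysics.PowerSystems
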